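import Literature.AnabelianGeometry.SemiGraphs.Prop36HypothesesWitnessLevelDictionary
import Literature.AnabelianGeometry.SemiGraphs.TemperedChartTransport
import Literature.AnabelianGeometry.SemiGraphs.TemperedMaximalCompactAt
import Literature.AnabelianGeometry.SemiGraphs.TemperedMaximalCompactProofsAt
import Literature.AnabelianGeometry.SemiGraphs.TemperedEdgeLikeDistinctOfAt
import Literature.AnabelianGeometry.SemiGraphs.TemperedVerticialNamedFactsProofs

/-!
# [SemiAnbd] Thm. 3.7 (iii)/(iv) hold AT the Prop. 3.6 / Thm. 3.7 witness, for every chart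

Mochizuki, *Semi-graphs of anabelioids*, Publ. RIMS **42** (2006) [MochizukiSemiAnbd2006], Thm. 3.7
(i)–(iv) pp. 264–265 (kurims pp. 40–41); Prop. 3.2 / Rmk. 3.2.1 p. 259 (kurims p. 35) ("`π₁^temp`
… well-defined, up to inner automorphism").

PROOF-ONLY (cell abc-iut, layer L3, rows WIT-1a/WIT-1c; seat abc-iut-w5-d212).  The named facts
`CompactInVerticial` (Thm. 3.7 (iii)) and `MaximalCompactIffVerticial` (Thm. 3.7 (iv)) of
`TemperedVerticial.lean` are, definitionally, `∀ 𝒢, …At 𝒢` (`TemperedCompactInVerticialAt.lean`).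
This file proves the At-forms at the witness `affWitness p` (one vertex with anabelioid
`B(Aff(ℤ_p))`, no edges) for EVERY chart `c` of its tempered fundamental group — not only for the
explicit chart `affChart p` of `Prop36HypothesesWitnessAffChart.lean`: by chart transport
(`TemperedPiChart.exists_compatIso`, Prop. 3.2) every chart's group is `Aff(ℤ_p)` up to an
isomorphism of topological groups (`nonempty_continuousMulEquiv_chart_affWitness`), its verticial
subgroups at the vertex are exactly `{⊤}` (`verticialSubgroups_chart_affWitness_eq`), it carries
finite-level data (`nonempty_finiteLevelData_chart_affWitness`, transported from
`affFiniteLevelData`), and hence — through the cell's assembly `FiniteLevelData.compactInVerticial`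
and the At-form reductions `edgeLikeIsInfVerticialAt_of`, `edgeLikeDistinctAt_of`,
`maximalCompactIffVerticialAt_of` with the PROVED Thm. 3.7 (i)/(ii) (`verticialInjective_holds`,
`verticialDistinct_holds`) — `CompactInVerticialAt`, `EdgeLikeIsInfVerticialAt`,
`EdgeLikeDistinctAt` and `MaximalCompactIffVerticialAt` all hold at `affWitness p`.  So the two
named facts, still hypotheses elsewhere in the tree, are THEOREMS at this instance of their own
standing hypotheses: a consistency / non-vacuity certificate, nothing more; no statement of the
paper is touched, strengthened or assumed.  Nothing here takes a side on [IUTchIII] Cor. 3.12.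
-/

noncomputable section

namespace Literature.AnabelianGeometry.SemiGraphs

namespace ProfiniteSemiGraph

open CategoryTheory Topology Literature.GroupTheory.SpecificGroups

variable {p : ℕ} [Fact p.Prime]

/-! ### Every chart of the witness, up to isomorphism -/

/-- **Every tempered fundamental group chart of the witness has group `Aff(ℤ_p)`** up to an
isomorphism of topological groups (Prop. 3.2 / Rmk. 3.2.1: charts are compatibly isomorphic;
transport from the explicit chart `affChart p`). [cite: MochizukiSemiAnbd2006, Prop 3.6(ii) p.38] -/
theorem nonempty_continuousMulEquiv_chart_affWitness (c : TemperedPiChart (affWitness p)) :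
    Nonempty (c.G ≃ₜ* PadicAffine p) := by
  obtain ⟨φ, ψ, hψφ, hφψ, -, -⟩ := TemperedPiChart.exists_compatIso c (affChart p)
  exact ⟨⟨⟨⟨φ, ψ, hψφ, hφψ⟩, fun x y => map_mul φ x y⟩, φ.continuous, ψ.continuous⟩⟩

/-- In particular every chart's group of the witness is compact. [cite: MochizukiSemiAnbd2006, Prop 3.6(ii) p.38] -/
theorem compactSpace_chart_affWitness (c : TemperedPiChart (affWitness p)) : CompactSpace c.G := by
  obtain ⟨e⟩ := nonempty_continuousMulEquiv_chart_affWitness c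
  exact e.toHomeomorph.symm.compactSpace

/-- **For every chart of the witness, the verticial subgroups at the vertex are exactly `{⊤}`**
(transport of `verticialSubgroups_affChart_eq` along a compatible isomorphism of charts).
[cite: MochizukiSemiAnbd2006, Thm 3.7(i) p.40] -/
theorem verticialSubgroups_chart_affWitness_eq (c : TemperedPiChart (affWitness p))
    (v : (affWitness p).graph.Vertex) : verticialSubgroups c v = {⊤} := by
  obtain ⟨φ, ψ, hψφ, hφψ, hφ, hψ⟩ := TemperedPiChart.exists_compatIso (affChart p) c
  ext H
  rw [mem_verticialSubgroups_iff_map φ hφ ψ hφψ hψ H, verticialSubgroups_affChart_eq,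
    Set.mem_singleton_iff, Set.mem_singleton_iff]
  constructor
  · intro h
    rw [eq_top_iff]
    intro y _
    have hy : ψ y ∈ H.map ψ.toMonoidHom := by rw [h]; exact Subgroup.mem_top _
    obtain ⟨z, hz, hzy⟩ := hy
    have hinj : Function.Injective ψ := fun a b hab => by
      have := congrArg φ hab
      rwa [hφψ, hφψ] at this
    exact (hinj hzy) ▸ hz
  · rintro rfl
    rw [eq_top_iff]
    intro x _
    exact ⟨φ x, Subgroup.mem_top _, hψφ x⟩

/-- **Every chart of the witness carries finite-level data** (transport of `affFiniteLevelData`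
along `FiniteLevelData.nonempty_of_nonempty`). [cite: MochizukiSemiAnbd2006, Thm 3.7(iii) p.41] -/
theorem nonempty_finiteLevelData_chart_affWitness (c : TemperedPiChart (affWitness p)) :
    Nonempty (FiniteLevelData.{0} (affWitness p) c) :=
  FiniteLevelData.nonempty_of_nonempty ⟨affFiniteLevelData p⟩ c

/-! ### Thm. 3.7 (iii), (iv) at the witness -/

/-- **Thm. 3.7 (iii) holds AT the witness** (`CompactInVerticialAt (affWitness p)`, every chart):
the cell's assembly `FiniteLevelData.compactInVerticial` on the transported finite-level data, with
Thm. 3.7 (ii) (`verticialDistinct_holds`) and the existence half of Thm. 3.7 (i)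
(`verticialInjective_holds`). [cite: MochizukiSemiAnbd2006, Thm 3.7(iii) pp.40-41] -/
theorem compactInVerticialAt_affWitness : CompactInVerticialAt (affWitness p) := by
  intro h37 c C hC
  obtain ⟨D⟩ := nonempty_finiteLevelData_chart_affWitness c
  exact FiniteLevelData.compactInVerticial D verticialDistinct_holds h37
    (fun v => (verticialInjective_holds _ h37 c v).1) C hC

/-- The rung-4 residual `EdgeLikeIsInfVerticialAt` holds at the witness. [cite: MochizukiSemiAnbd2006, Thm 3.7(iv) p.41] -/
theorem edgeLikeIsInfVerticialAt_affWitness : EdgeLikeIsInfVerticialAt (affWitness p) :=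
  edgeLikeIsInfVerticialAt_of compactInVerticialAt_affWitness verticialDistinct_holds
    verticialInjective_holds

/-- Thm. 3.7 (ii), edge form, holds at the witness (`EdgeLikeDistinctAt`).
[cite: MochizukiSemiAnbd2006, Thm 3.7(ii)(iv) pp.40-41] -/
theorem edgeLikeDistinctAt_affWitness : EdgeLikeDistinctAt (affWitness p) :=
  edgeLikeDistinctAt_of compactInVerticialAt_affWitness verticialDistinct_holds
    verticialInjective_holds

/-- **Thm. 3.7 (iv) holds AT the witness** (`MaximalCompactIffVerticialAt (affWitness p)`, every
chart). [cite: MochizukiSemiAnbd2006, Thm 3.7(iv) p.41] -/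
theorem maximalCompactIffVerticialAt_affWitness : MaximalCompactIffVerticialAt (affWitness p) :=
  maximalCompactIffVerticialAt_of compactInVerticialAt_affWitness verticialDistinct_holds
    edgeLikeIsInfVerticialAt_affWitness

/-- Consequently, for every chart of the witness, the maximal compact subgroups of `π₁^temp` are
exactly the verticial ones, i.e. exactly `⊤` (Thm. 3.7 (iv) read off at the witness).
[cite: MochizukiSemiAnbd2006, Thm 3.7(iv) p.41] -/
theorem isMaximalCompactSubgroup_iff_eq_top_chart_affWitness (c : TemperedPiChart (affWitness p))
    (K : Subgroup c.G) : IsMaximalCompactSubgroup K ↔ K = ⊤ := by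
  rw [(maximalCompactIffVerticialAt_affWitness affWitness_thm37Hypotheses c).1 K]
  constructor
  · rintro ⟨v, hv⟩
    rw [verticialSubgroups_chart_affWitness_eq c v] at hv
    exact hv
  · rintro rfl
    exact ⟨PUnit.unit, by rw [verticialSubgroups_chart_affWitness_eq]; rfl⟩

/-- Non-vacuity of the two still-conditional named facts at one instance of their hypotheses: some
`𝒢` satisfying the hypotheses of Thm. 3.7 satisfies `CompactInVerticialAt` and
`MaximalCompactIffVerticialAt`. [cite: MochizukiSemiAnbd2006, Thm 3.7(iii)(iv) pp.40-41] -/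
theorem exists_thm37Hypotheses_and_compactInVerticialAt :
    ∃ 𝒢 : ProfiniteSemiGraph.{0}, 𝒢.Thm37Hypotheses ∧ CompactInVerticialAt 𝒢 ∧
      MaximalCompactIffVerticialAt 𝒢 :=
  ⟨@affWitness 2 ⟨Nat.prime_two⟩, @affWitness_thm37Hypotheses 2 ⟨Nat.prime_two⟩,
    @compactInVerticialAt_affWitness 2 ⟨Nat.prime_two⟩,
    @maximalCompactIffVerticialAt_affWitness 2 ⟨Nat.prime_two⟩⟩

end ProfiniteSemiGraph

end Literature.AnabelianGeometry.SemiGraphs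

end
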